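import Mathlib.LinearAlgebra.Matrix.NonsingularInverse
import Literature.NumberTheory.Automorphic.ReductiveGroupData
import Literature.NumberTheory.Automorphic.TwistedJacquetAdditive
import HarnessLib

/-!
# Principal congruence subgroups of `GL_n(F)` over a non-archimedean local field

For a non-archimedean local field `F` (`[ValuativeRel F] [IsNonarchimedeanLocalField F]`) and
`s ∈ F`, the **principal congruence subgroup** `K_s = congrGL n s ≤ GL_n(F)` consists of the
matrices `g` with `g`, `g⁻¹` integral and `g ≡ 1 (mod s𝒪)` entrywise (for `s = ϖ^m` this is
`1 + ϖ^m M_n(𝒪)`; Bushnell–Henniart 2006, §12.4 / §7.1; Bernstein–Zelevinsky 1976, §1.1; the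
`ValuativeRel` analogue of `Literature.NumberTheory.Automorphic.valuedCongruenceSubgroup` of
`GLnAdelicStructure`, which is phrased for `Valued` fields). We prove:

* `congrGL n s` is an open compact subgroup contained in `GL_n(𝒪) = glInt n F`
  (`isOpen_congrGL`, `isCompact_congrGL`, `congrGL_le_glInt`);
* **integrality of the inverse** (`exists_inverse_integral`, `mem_congrGL_of_val_le`): a
  matrix with integral entries congruent to `1` modulo `s𝒪`, `|s| < 1`, is invertible with
  integral inverse — its determinant is `≡ 1 (mod 𝓂)`, hence a unit of the local ring `𝒪`
  (Mathlib `Matrix.isUnit_iff_isUnit_det`, `RingHom.map_det`, `IsLocalRing`); so membership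
  in `K_s` can be checked on `g` alone;
* **the `K_s` form a neighbourhood basis of `1`** in `GL_n(F)` (`exists_congrGL_subset`): the
  topology of `GL_n(F) = (M_n(F))ˣ` is induced by `g ↦ (g, g⁻¹)` into `M_n(F) × M_n(F)ᵐᵒᵖ`
  (Mathlib `Units.isInducing_embedProduct`) and that of `M_n(F)` is the product topology
  (Bernstein–Zelevinsky 1976, §1.1: `GL_n(F)` is an `l`-group with the `K_m` as a basis of
  neighbourhoods of the identity).

## References

* C. J. Bushnell, G. Henniart, *The local Langlands conjecture for `GL(2)`* (2006), §7.1,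
  §12.4 (`BushnellHenniart2006`; not held).
* I. N. Bernstein, A. V. Zelevinsky, *Representations of the group `GL(n,F)` where `F` is a
  non-archimedean local field*, Russian Math. Surveys 31:3 (1976), §1.1
  (`BernsteinZelevinskyRMS1976`; not held).
-/

open scoped BigOperators Topology
open ValuativeRel Matrix

namespace Literature.NumberTheory.Automorphic

open TwistedJacquet

/-! ### Entry bounds -/

section Bounds

variable {F : Type*} [Field F] [ValuativeRel F] {ι : Type*} [Fintype ι]

/-- Ultrametric bound for the entries of a product. [folklore] -/
theorem valuation_mul_apply_le {A B : Matrix ι ι F} {a b : ValueGroupWithZero F}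
    (hA : ∀ i j, valuation F (A i j) ≤ a) (hB : ∀ i j, valuation F (B i j) ≤ b) (i j : ι) :
    valuation F ((A * B) i j) ≤ a * b := by
  rw [Matrix.mul_apply]
  refine (valuation F).map_sum_le fun l _ => ?_
  rw [map_mul]
  exact mul_le_mul' (hA i l) (hB l j)

end Bounds

/-! ### The principal congruence subgroups -/

section Congr

variable (n : ℕ) {F : Type*} [Field F] [ValuativeRel F]

/-- The **principal congruence subgroup** `K_s ≤ GL_n(F)`: invertible matrices `g` with `g` and
`g⁻¹` integral and `g ≡ 1 (mod s𝒪)` entrywise (for `s = ϖ^m`, `K_s = 1 + ϖ^m M_n(𝒪)`).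
(Bushnell–Henniart 2006, §12.4; Bernstein–Zelevinsky 1976, §1.1; the `ValuativeRel` analogue of
`valuedCongruenceSubgroup`.) [folklore] -/
def congrGL (s : F) : Subgroup (GL (Fin n) F) where
  carrier := {g | (∀ i j, valuation F ((g : Matrix (Fin n) (Fin n) F) i j) ≤ 1) ∧
    (∀ i j, valuation F (((g⁻¹ : GL (Fin n) F) : Matrix (Fin n) (Fin n) F) i j) ≤ 1) ∧
    ∀ i j, valuation F (((g : Matrix (Fin n) (Fin n) F) - 1) i j) ≤ valuation F s}
  one_mem' := by
    refine ⟨fun i j => ?_, fun i j => ?_, fun i j => ?_⟩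
    · rw [Units.val_one, Matrix.one_apply]
      split_ifs <;> simp
    · rw [inv_one, Units.val_one, Matrix.one_apply]
      split_ifs <;> simp
    · simp
  mul_mem' := by
    rintro g h ⟨hg₁, hg₂, hg₃⟩ ⟨hh₁, hh₂, hh₃⟩
    refine ⟨fun i j => ?_, fun i j => ?_, fun i j => ?_⟩
    · simpa using valuation_mul_apply_le hg₁ hh₁ i j
    · rw [_root_.mul_inv_rev]
      simpa using valuation_mul_apply_le hh₂ hg₂ i j
    · have hgh : ((g * h : GL (Fin n) F) : Matrix (Fin n) (Fin n) F) - 1 =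
          ((g : Matrix (Fin n) (Fin n) F) - 1) * (h : Matrix (Fin n) (Fin n) F) +
            ((h : Matrix (Fin n) (Fin n) F) - 1) := by
        rw [Units.val_mul, sub_mul, one_mul, sub_add_sub_cancel]
      rw [hgh, Matrix.add_apply]
      refine (valuation F).map_add_le ?_ (hh₃ i j)
      simpa using valuation_mul_apply_le hg₃ hh₁ i j
  inv_mem' := by
    rintro g ⟨hg₁, hg₂, hg₃⟩
    refine ⟨hg₂, fun i j => by simpa using hg₁ i j, fun i j => ?_⟩
    have hg : ((g⁻¹ : GL (Fin n) F) : Matrix (Fin n) (Fin n) F) - 1 =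
        -(((g⁻¹ : GL (Fin n) F) : Matrix (Fin n) (Fin n) F) * ((g : Matrix (Fin n) (Fin n) F) - 1)) := by
      rw [mul_sub, mul_one, Units.inv_mul, neg_sub]
    rw [hg, Matrix.neg_apply, Valuation.map_neg]
    simpa using valuation_mul_apply_le hg₂ hg₃ i j

variable {n}

/-- Membership in `congrGL n s` (definitional unfolding). [folklore] -/
theorem mem_congrGL_iff {s : F} {g : GL (Fin n) F} :
    g ∈ congrGL n s ↔ (∀ i j, valuation F ((g : Matrix (Fin n) (Fin n) F) i j) ≤ 1) ∧
      (∀ i j, valuation F (((g⁻¹ : GL (Fin n) F) : Matrix (Fin n) (Fin n) F) i j) ≤ 1) ∧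
      ∀ i j, valuation F (((g : Matrix (Fin n) (Fin n) F) - 1) i j) ≤ valuation F s :=
  Iff.rfl

/-- For `g ∈ K_s` the inverse is also congruent to `1`: `|(g⁻¹ - 1)_{ij}| ≤ |s|`. [folklore] -/
theorem valuation_inv_sub_one_le {s : F} {g : GL (Fin n) F} (hg : g ∈ congrGL n s) (i j : Fin n) :
    valuation F ((((g⁻¹ : GL (Fin n) F) : Matrix (Fin n) (Fin n) F) - 1) i j) ≤ valuation F s :=
  ((congrGL n s).inv_mem hg).2.2 i j

/-- `K_s ≤ GL_n(𝒪)`. [folklore] -/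
theorem congrGL_le_glInt (s : F) : congrGL n s ≤ glInt n F := by
  intro g hg
  rw [mem_glInt_iff]
  exact ⟨fun i j => (Valuation.mem_integer_iff _ _).2 (hg.1 i j),
    fun i j => (Valuation.mem_integer_iff _ _).2 (hg.2.1 i j)⟩

/-- `K_s` is decreasing in `|s|`. [folklore] -/
theorem congrGL_mono {s s' : F} (h : valuation F s ≤ valuation F s') : congrGL n s ≤ congrGL n s' :=
  fun _ hg => ⟨hg.1, hg.2.1, fun i j => (hg.2.2 i j).trans h⟩

end Congr

/-! ### Integrality of the inverse -/

section Inverse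

variable {F : Type*} [Field F] [ValuativeRel F] [TopologicalSpace F] [IsNonarchimedeanLocalField F]
  {ι : Type*} [Fintype ι] [DecidableEq ι]

/-- **Integrality of the inverse**: an integral matrix `M` over a non-archimedean local field with
`|M_{ij} - δ_{ij}| < 1` is invertible with an integral inverse: over the local ring `𝒪[F]` its
determinant reduces to `det 1 = 1` in the residue field, hence is a unit. [folklore] -/
theorem exists_inverse_integral (M : Matrix ι ι F) (hint : ∀ i j, valuation F (M i j) ≤ 1)
    (hsmall : ∀ i j, valuation F (M i j - (1 : Matrix ι ι F) i j) < 1) :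
    ∃ N : Matrix ι ι F, (∀ i j, valuation F (N i j) ≤ 1) ∧ M * N = 1 ∧ N * M = 1 := by
  -- the matrix over `𝒪[F]`
  let M' : Matrix ι ι 𝒪[F] := Matrix.of fun i j => ⟨M i j, (Valuation.mem_integer_iff _ _).2 (hint i j)⟩
  have hM' : M'.map (algebraMap 𝒪[F] F) = M := by
    ext i j; rfl
  -- its reduction is the identity
  have hred : M'.map (IsLocalRing.residue 𝒪[F]) = 1 := by
    ext i j
    rw [Matrix.map_apply, Matrix.one_apply]
    have hij : M' i j - (1 : Matrix ι ι 𝒪[F]) i j ∈ 𝓂[F] := by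
      rw [IsLocalRing.mem_maximalIdeal, mem_nonunits_iff,
        (Valuation.integer.integers (valuation F)).isUnit_iff_valuation_eq_one]
      have : ((M' i j - (1 : Matrix ι ι 𝒪[F]) i j : 𝒪[F]) : F) = M i j - (1 : Matrix ι ι F) i j := by
        simp only [M', Matrix.of_apply, Matrix.one_apply]
        split_ifs <;> simp
      intro h
      have h' : valuation F ((M' i j - (1 : Matrix ι ι 𝒪[F]) i j : 𝒪[F]) : F) = 1 := h
      rw [this] at h'
      exact absurd h' (hsmall i j).ne
    have := (IsLocalRing.residue_eq_zero_iff _).2 hij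
    rw [map_sub, sub_eq_zero] at this
    rw [this, Matrix.one_apply]
    split_ifs <;> simp
  have hdet : IsUnit M'.det := by
    have hres : IsLocalRing.residue 𝒪[F] M'.det ≠ 0 := by
      rw [RingHom.map_det, RingHom.mapMatrix_apply, hred, Matrix.det_one]
      exact one_ne_zero
    by_contra h
    exact hres ((IsLocalRing.residue_eq_zero_iff _).2
      ((IsLocalRing.mem_maximalIdeal _).2 (mem_nonunits_iff.2 h)))
  obtain ⟨u, hu⟩ := (Matrix.isUnit_iff_isUnit_det M').2 hdet
  let f : Matrix ι ι 𝒪[F] →+* Matrix ι ι F := (algebraMap 𝒪[F] F).mapMatrix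
  have hfM : f M' = M := hM'
  refine ⟨f ↑u⁻¹, fun i j => ?_, ?_, ?_⟩
  · change valuation F ((((↑u⁻¹ : Matrix ι ι 𝒪[F]) i j : 𝒪[F]) : F)) ≤ 1
    exact (Valuation.mem_integer_iff _ _).1 ((↑u⁻¹ : Matrix ι ι 𝒪[F]) i j).2
  · rw [← hfM, ← map_mul, ← hu, Units.mul_inv, map_one]
  · rw [← hfM, ← map_mul, ← hu, Units.inv_mul, map_one]

/-- **Membership in `K_s` is a condition on `g` alone** (`|s| < 1`): if `g` is integral and
`g ≡ 1 (mod s𝒪)` then `g⁻¹` is integral, so `g ∈ K_s`. [folklore] -/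
theorem mem_congrGL_of_val_le {n : ℕ} {s : F} (hs : valuation F s < 1) {g : GL (Fin n) F}
    (hint : ∀ i j, valuation F ((g : Matrix (Fin n) (Fin n) F) i j) ≤ 1)
    (hsmall : ∀ i j, valuation F (((g : Matrix (Fin n) (Fin n) F) - 1) i j) ≤ valuation F s) :
    g ∈ congrGL n s := by
  obtain ⟨N, hN, hgN, -⟩ := exists_inverse_integral (g : Matrix (Fin n) (Fin n) F) hint
    fun i j => by
      have := hsmall i j
      rw [Matrix.sub_apply] at this
      exact this.trans_lt hs
  have hinv : ((g⁻¹ : GL (Fin n) F) : Matrix (Fin n) (Fin n) F) = N := by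
    calc ((g⁻¹ : GL (Fin n) F) : Matrix (Fin n) (Fin n) F)
        = ((g⁻¹ : GL (Fin n) F) : Matrix (Fin n) (Fin n) F) * ((g : Matrix (Fin n) (Fin n) F) * N) := by
          rw [hgN, mul_one]
      _ = N := by rw [← mul_assoc, Units.inv_mul, one_mul]
  refine ⟨hint, fun i j => ?_, hsmall⟩
  rw [hinv]
  exact hN i j

end Inverse

/-! ### Topology: `K_s` is open and compact, and the `K_s` form a neighbourhood basis of `1` -/

section TopologyGL

variable {n : ℕ} {F : Type*} [Field F] [ValuativeRel F] [TopologicalSpace F] [IsNonarchimedeanLocalField F]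

/-- `K_s` is open for `s ≠ 0`. [folklore] -/
theorem isOpen_congrGL {s : F} (hs : s ≠ 0) : IsOpen (congrGL n s : Set (GL (Fin n) F)) := by
  have hval : Continuous fun g : GL (Fin n) F => (g : Matrix (Fin n) (Fin n) F) := Units.continuous_val
  have hinv : Continuous fun g : GL (Fin n) F => ((g⁻¹ : GL (Fin n) F) : Matrix (Fin n) (Fin n) F) :=
    Units.continuous_coe_inv
  have h1 : IsOpen {x : F | valuation F x ≤ 1} := by
    have : {x : F | valuation F x ≤ 1} = (ball (1 : F) : Set F) := by
      ext x; simp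
    rw [this]; exact isOpen_ball one_ne_zero
  have h2 : IsOpen {x : F | valuation F x ≤ valuation F s} := isOpen_ball hs
  have hset : (congrGL n s : Set (GL (Fin n) F)) =
      (⋂ i, ⋂ j, {g : GL (Fin n) F | valuation F ((g : Matrix (Fin n) (Fin n) F) i j) ≤ 1}) ∩
      ((⋂ i, ⋂ j, {g : GL (Fin n) F |
          valuation F (((g⁻¹ : GL (Fin n) F) : Matrix (Fin n) (Fin n) F) i j) ≤ 1}) ∩
       ⋂ i, ⋂ j, {g : GL (Fin n) F |
          valuation F (((g : Matrix (Fin n) (Fin n) F) - 1) i j) ≤ valuation F s}) := by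
    ext g
    simp only [SetLike.mem_coe, mem_congrGL_iff, Set.mem_inter_iff, Set.mem_iInter, Set.mem_setOf_eq]
  rw [hset]
  refine (isOpen_iInter_of_finite fun i => isOpen_iInter_of_finite fun j => ?_).inter
    ((isOpen_iInter_of_finite fun i => isOpen_iInter_of_finite fun j => ?_).inter
      (isOpen_iInter_of_finite fun i => isOpen_iInter_of_finite fun j => ?_))
  · exact h1.preimage (hval.matrix_elem i j)
  · exact h1.preimage (hinv.matrix_elem i j)
  · exact h2.preimage ((hval.matrix_elem i j).sub continuous_const)

/-- `K_s` is compact for `s ≠ 0` (a closed — since open — subgroup of the compact `GL_n(𝒪)`).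
[folklore] -/
theorem isCompact_congrGL {s : F} (hs : s ≠ 0) : IsCompact (congrGL n s : Set (GL (Fin n) F)) :=
  (isCompact_glInt n F).of_isClosed_subset ((congrGL n s).isClosed_of_isOpen (isOpen_congrGL hs))
    (SetLike.coe_subset_coe.2 (congrGL_le_glInt s))

omit [TopologicalSpace F] [IsNonarchimedeanLocalField F] in
/-- Finitely many non-zero elements have a common non-zero "lower bound" for the valuation.
[folklore] -/
theorem exists_valuation_le_of_finset {ι : Type*} (T : Finset ι) (f : ι → F) (hf : ∀ i, f i ≠ 0) :
    ∃ s : F, s ≠ 0 ∧ ∀ i ∈ T, valuation F s ≤ valuation F (f i) := by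
  classical
  induction T using Finset.induction_on with
  | empty => exact ⟨1, one_ne_zero, fun i hi => absurd hi (Finset.notMem_empty i)⟩
  | insert a T ha ih =>
    obtain ⟨s, hs, h⟩ := ih
    obtain ⟨u, hu, hus, hua⟩ := exists_valuation_le_le s (f a) hs (hf a)
    refine ⟨u, hu, fun i hi => ?_⟩
    rcases Finset.mem_insert.1 hi with rfl | hi
    · exact hua
    · exact hus.trans (h i hi)

/-- **Boxes in `M_n(F)`**: every neighbourhood of `M₀` contains all matrices entrywise congruent
to `M₀` modulo some lattice `s𝒪`, `s ≠ 0` (product topology). [folklore] -/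
theorem exists_forall_valuation_le_mem {M₀ : Matrix (Fin n) (Fin n) F} {O : Set (Matrix (Fin n) (Fin n) F)}
    (hO : O ∈ 𝓝 M₀) : ∃ s : F, s ≠ 0 ∧ ∀ M : Matrix (Fin n) (Fin n) F,
      (∀ i j, valuation F (M i j - M₀ i j) ≤ valuation F s) → M ∈ O := by
  have hO' : O ∈ 𝓝 (show Fin n → Fin n → F from M₀) := hO
  rw [nhds_pi] at hO'
  obtain ⟨I, t, ht, hsub⟩ := Filter.mem_pi'.1 hO'
  have ht' : ∀ i, ∃ J : Finset (Fin n), ∃ t' : Fin n → Set F,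
      (∀ j, t' j ∈ 𝓝 (M₀ i j)) ∧ Set.pi (↑J) t' ⊆ t i := fun i => by
    have := ht i
    rw [nhds_pi] at this
    exact Filter.mem_pi'.1 this
  choose J t' ht' hsub' using ht'
  have hs : ∀ i j, ∃ s : F, s ≠ 0 ∧ (ball s : Set F) ⊆ (fun x => x + M₀ i j) ⁻¹' t' i j := by
    intro i j
    refine exists_ball_subset_of_mem_nhds ?_
    refine (continuous_add_const _).continuousAt.preimage_mem_nhds ?_
    rw [zero_add]
    exact ht' i j
  choose s hs0 hsball using hs
  obtain ⟨s₀, hs₀, hle⟩ := exists_valuation_le_of_finset Finset.univ (fun p : Fin n × Fin n => s p.1 p.2)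
    fun p => hs0 p.1 p.2
  refine ⟨s₀, hs₀, fun M hM => hsub fun i _ => hsub' i fun j _ => ?_⟩
  have hmem : M i j - M₀ i j ∈ ball (s i j) :=
    mem_ball_iff.2 ((hM i j).trans (hle (i, j) (Finset.mem_univ _)))
  have := hsball i j hmem
  simpa using this

/-- **The congruence subgroups form a neighbourhood basis of `1` in `GL_n(F)`**
(Bernstein–Zelevinsky 1976, §1.1): every neighbourhood of `1` contains `K_s` for some `s ≠ 0`
with `|s| < 1`. The topology of `GL_n(F) = M_n(F)ˣ` is induced by `g ↦ (g, g⁻¹)`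
(Mathlib `Units.isInducing_embedProduct`). [folklore] -/
theorem exists_congrGL_subset {W : Set (GL (Fin n) F)} (hW : W ∈ 𝓝 (1 : GL (Fin n) F)) :
    ∃ s : F, s ≠ 0 ∧ valuation F s < 1 ∧ (congrGL n s : Set (GL (Fin n) F)) ⊆ W := by
  rw [Units.isInducing_embedProduct.nhds_eq_comap, map_one, Filter.mem_comap] at hW
  obtain ⟨O, hO, hOW⟩ := hW
  obtain ⟨u, hu, v, hv, huv⟩ := mem_nhds_prod_iff.1 hO
  have hv' : MulOpposite.op ⁻¹' v ∈ 𝓝 (1 : Matrix (Fin n) (Fin n) F) :=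
    MulOpposite.continuous_op.continuousAt.preimage_mem_nhds hv
  obtain ⟨s₁, hs₁, h₁⟩ := exists_forall_valuation_le_mem hu
  obtain ⟨s₂, hs₂, h₂⟩ := exists_forall_valuation_le_mem hv'
  obtain ⟨s₃, hs₃, h₃₁, h₃₂⟩ := exists_valuation_le_le s₁ s₂ hs₁ hs₂
  obtain ⟨s₄, hs₄, h₄₃, h₄₁⟩ := exists_valuation_le_le s₃ 1 hs₃ one_ne_zero
  obtain ⟨ϖ, hϖ0, hϖ1, -⟩ := exists_uniformizer (F := F)
  refine ⟨s₄ * ϖ, mul_ne_zero hs₄ hϖ0, ?_, fun g hg => ?_⟩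
  · rw [map_mul]
    calc valuation F s₄ * valuation F ϖ ≤ 1 * valuation F ϖ := mul_le_mul' (by simpa using h₄₁) le_rfl
      _ < 1 := by rw [one_mul]; exact hϖ1
  · have hle : valuation F (s₄ * ϖ) ≤ valuation F s₃ := by
      rw [map_mul]
      calc valuation F s₄ * valuation F ϖ ≤ valuation F s₄ * 1 := mul_le_mul' le_rfl hϖ1.le
        _ = valuation F s₄ := mul_one _
        _ ≤ valuation F s₃ := h₄₃
    apply hOW
    rw [Set.mem_preimage]
    apply huv
    refine ⟨h₁ _ fun i j => ?_, ?_⟩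
    · have := hg.2.2 i j
      rw [Matrix.sub_apply] at this
      simpa using this.trans (hle.trans h₃₁)
    · change MulOpposite.op (((g⁻¹ : GL (Fin n) F)) : Matrix (Fin n) (Fin n) F) ∈ v
      have hmem : ((g⁻¹ : GL (Fin n) F) : Matrix (Fin n) (Fin n) F) ∈ MulOpposite.op ⁻¹' v := by
        refine h₂ _ fun i j => ?_
        have := valuation_inv_sub_one_le hg i j
        rw [Matrix.sub_apply] at this
        simpa using this.trans (hle.trans h₃₂)
      exact hmem

/-- **Smooth vectors are fixed by a congruence subgroup**: a vector with open stabiliser in a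
representation of `GL_n(F)` is fixed by `K_s` for some `s ≠ 0`, `|s| < 1`. [folklore] -/
theorem exists_congrGL_le_stabilizer {V : Type*} [AddCommGroup V] [Module ℂ V]
    (π : Representation ℂ (GL (Fin n) F) V) {v : V} (hv : π.IsSmoothVector v) :
    ∃ s : F, s ≠ 0 ∧ valuation F s < 1 ∧ congrGL n s ≤ π.stabilizerSubgroup v := by
  obtain ⟨s, hs, hs1, hsub⟩ := exists_congrGL_subset (hv.mem_nhds (by simp))
  exact ⟨s, hs, hs1, fun g hg => hsub hg⟩

end TopologyGL

end Literature.NumberTheory.Automorphic
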